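import Summits.QuantumFields.YangMills.Theorems.MirrorModularBoostsSoftKernelBoostCovarianceAsmGeometryMargins
import Summits.QuantumFields.YangMills.Theorems.MirrorModularBoostsSoftKernelBoostCovarianceAsmGeometryRot
import Summits.QuantumFields.YangMills.Theorems.MirrorModularBoostsSoftKernelBoostCovarianceAsmSuperpositionTools
import Summits.QuantumFields.YangMills.Theorems.MirrorModularBoostsSoftKernelBoostCovarianceAsmConstantsAndBumps
import Summits.QuantumFields.YangMills.Theorems.MirrorModularBoostsSoftKernelBoostCovarianceBumpChain
import Summits.QuantumFields.YangMills.Theorems.MirrorModularBoostsSoftKernelBoostCovarianceAsmBumpChainOps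
import Summits.QuantumFields.YangMills.Theorems.MirrorModularBoostsSoftKernelBoostCovarianceBumpChainLink
import Summits.QuantumFields.YangMills.Theorems.MirrorModularBoostsSoftKernelBoostCovarianceLowerBlock
import Summits.QuantumFields.YangMills.Theorems.MirrorModularBoostsSoftKernelBoostCovarianceInsertionOps

/-!
# Assembly piece (A3) — the chain of a term with a FREE LOWER BLOCK (sub-threshold type)

Line `Sketch` of crux `MirrorModularBoosts.SoftKernelBoostCovariance` (stmt-QuantumFields-14999): a piece of the lead's
assembly (T7) of the registered skeleton `Cruxes/SoftKernelBoostCovariance/Lines/Sketch.lean` (v3.5), model-blind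
Osterwalder–Schrader bookkeeping over the `e₀`-reconstruction `h`.

**Statement** (`stub_asmTermChainFree`, registered).  For a radial-bump tensor `T` of degree `m + 1` (one profile `φ`
of radius `ρ ≤ δ/32`, items `f0 j`, transverse profiles `hh j` controlled by `A`, centres `c j` whose rotated times are
`≥ δ` with consecutive gaps `≥ δ/2` for `|θ| < ε`), a reserve `u` with `2ρ ≤ u`, `u e^{R} ≤ δ/16`, a cone family `N`, the
sandwich bound with exponent `μ` and constant `C`, translation invariance and PLANAR INVARIANCE OF `𝔖_{m+m}` on `⁰𝒮`:
`R_θ T` is time-ordered for `|θ| < ε`, and `Ψ_{R_θ T}` are the real values of a family holomorphic on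
`{|Re ζ| < ε, |Im ζ| < R}` bounded by `max(C·1·(A+A)·(u^{-μ}+u^{-μ})) 0 · K_{δ/16}^m · ‖Ψ_1‖` — ONE height-dependent
insertion constant times the FIXED-reserve chain constant of the tail.

**Proof.**  Tail `Y` = bump tensor of the items `1, …, m` (`exists_bumpTensor_asm`).  The landed (G)
`stub_asmBumpChainOps` four times: on `T` from `q = 0`, `w = 0` (time-ordering of `R_θ T`, `cfg_zero_eq`); on `Y` from
`q = c 0` (a) at height `R`, reserve `u`, pull-back `u + u - ρ` (a family `Va`), (b) at height `1/4`, reserve `δ/16`,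
pull-back `δ/8`, read at the real points (`‖Ψ_{Ỹ_θ}‖ ≤ K_{δ/16}^m ‖Ψ_1‖`; `e^{-1/4} ≥ 3/4`), (c) pull-back `2·(δ/8)`
(time-ordering of the advanced tail).  The landed lower block (T5) `stub_lowerBlock` with `g = δ/8` (`(u+u-ρ)e^{R} ≤ δ/8`)
gives `‖Va ζ‖ ≤ ‖Ψ_{Ỹ_{Re ζ}}‖ ≤ K_{δ/16}^m ‖Ψ_1‖`.  Item `0` at reserve `u` and its insertion operator (T1 + sandwich,
`exists_item_insertionOp_free`), and the landed link (T3a) `stub_bumpChainLink` with `q = 0`, `w = 0`, `M := K_{δ/16}^m ‖Ψ_1‖`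
(first gap `≥ δ`, `u + ρ ≤ δ e^{-R}`, `tube_of_gap`); its `G` is `R_θ T` (`cfg_apply_bc`, `Fin.prod_univ_succ`).

References: J. Glimm, A. Jaffe, *Quantum Physics* (2nd ed. 1987), §19.5–19.7; K. Osterwalder, R. Schrader, CMP 42 (1975) §V.
-/

noncomputable section

namespace Summit.QuantumFields.YangMills.Theorems.SoftKernelBoostCovariance.Sketch

open scoped BigOperators SchwartzMap InnerProductSpace
open MeasureTheory Filter Topology
open Literature.MathematicalPhysics.QuantumLattice Literature.MathematicalPhysics.AQFT
  Literature.MathematicalPhysics.QuantumFieldTheory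
open Summit.QuantumFields.YangMills.Theorems.NPointIsotropy.Negative (E4)
open Summit.QuantumFields.YangMills.Theorems.CurvatureBoostCovariance.Negative
  (OSPackage Translations Hypercubic EightFrameRP PlanarCone PlanarInvariant)
open Summit.QuantumFields.YangMills.Cruxes.PlanarSpectralCone.PositivityDiscToOperatorCone.Density
  (isTimeOrdered_add fieldVec_add fieldVec_smul fieldVec_congr fieldVec_zero tendsto_fieldVec)

/-- **An item at reserve `u` and its insertion operator** (T1 + the sandwich bound): the radial item
`f = τ_{(u+ρ)e₀} f0` (planar profile supported at times in `[u, u + 2ρ] ⊆ [u, 2u]`, unit `L¹` mass, transverse profile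
controlled by `A` in `L¹` and `L^∞`) is prepended to `(2u+u)e₀`-translates of degree-`n` field vectors by a bounded
operator of norm `≤ max (C·1·(A+A)·(u^{-μ}+u^{-μ})) 0`. -/
theorem exists_item_insertionOp_free {S₁ : SchwingerFamily E4} (h : OSReconstructionNoE1 S₁.toLabelled) {μ C : ℝ}
    (hS : ∀ (u v : ℝ), 0 < u → 0 < v → u ≤ 1 → v ≤ 1 →
           ∀ (f₁ : SchwartzMap (Fin 1 → E4) ℂ) (g hh : ℝ × ℝ → ℂ) (Mg Mh Mh' : ℝ),
             (∀ x : Fin 1 → E4, f₁ x = g (x 0 0, x 0 1) * hh (x 0 2, x 0 3)) →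
             (∀ p : ℝ × ℝ, g p ≠ 0 → u ≤ p.1 ∧ p.1 ≤ 2 * u) →
             MeasureTheory.Integrable g → (∫ p, ‖g p‖) ≤ Mg →
             MeasureTheory.Integrable hh → (∫ p, ‖hh p‖) ≤ Mh → (∀ p, ‖hh p‖ ≤ Mh') →
           ∀ (n : ℕ) (W : SchwartzMap (Fin n → E4) ℂ) (hW : IsTimeOrdered W)
             (hFW : IsTimeOrdered
               (SchwartzMap.appendTensor f₁ (translateMulti ((2 * u + v) • EuclideanSpace.single 0 1) W))),
             ‖h.fieldVec (1 + n) (fun _ => ())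
                 (SchwartzMap.appendTensor f₁ (translateMulti ((2 * u + v) • EuclideanSpace.single 0 1) W)) hFW‖
               ≤ C * Mg * (Mh + Mh') * (u ^ (-μ) + v ^ (-μ)) * ‖h.fieldVec n (fun _ => ()) W hW‖)
    {u ρ A : ℝ} {φ : ℝ → ℂ} {hh : ℝ × ℝ → ℂ} (f0 : SchwartzMap (Fin 1 → E4) ℂ)
    (hρ : 0 < ρ) (h2ρ : 2 * ρ ≤ u) (hu1 : u ≤ 1)
    (hφ : ∀ s : ℝ, ρ ^ 2 < s → φ s = 0)
    (hφi : MeasureTheory.Integrable (fun p : ℝ × ℝ => φ (p.1 ^ 2 + p.2 ^ 2)))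
    (hφ1 : (∫ p : ℝ × ℝ, ‖φ (p.1 ^ 2 + p.2 ^ 2)‖) ≤ 1)
    (hf0 : ∀ x : Fin 1 → E4, f0 x = φ ((x 0 0) ^ 2 + (x 0 1) ^ 2) * hh (x 0 2, x 0 3))
    (hhh : MeasureTheory.Integrable hh ∧ (∫ p : ℝ × ℝ, ‖hh p‖) ≤ A ∧ ∀ p : ℝ × ℝ, ‖hh p‖ ≤ A) (n : ℕ) :
    ∃ (f : SchwartzMap (Fin 1 → E4) ℂ) (B : h.Hilbert →L[ℂ] h.Hilbert),
      (∀ x : Fin 1 → E4, f x = φ ((x 0 0 - (u + ρ)) ^ 2 + (x 0 1) ^ 2) * hh (x 0 2, x 0 3)) ∧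
      ‖B‖ ≤ max (C * 1 * (A + A) * (u ^ (-μ) + u ^ (-μ))) 0 ∧
      ∀ (W : SchwartzMap (Fin n → E4) ℂ) (hW : IsTimeOrdered W)
        (hFW : IsTimeOrdered (SchwartzMap.appendTensor f
          (translateMulti ((2 * u + u) • EuclideanSpace.single 0 1) W))),
        B (h.fieldVec n (fun _ => ()) W hW) =
          h.fieldVec (1 + n) (fun _ => ()) (SchwartzMap.appendTensor f
            (translateMulti ((2 * u + u) • EuclideanSpace.single 0 1) W)) hFW := by
  have hu : 0 < u := by linarith
  set f : SchwartzMap (Fin 1 → E4) ℂ := translateMulti ((u + ρ) • EuclideanSpace.single 0 1) f0 with hf_def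
  have hf : ∀ x : Fin 1 → E4, f x = φ ((x 0 0 - (u + ρ)) ^ 2 + (x 0 1) ^ 2) * hh (x 0 2, x 0 3) := by
    intro x
    rw [hf_def, translateMulti_apply, hf0]
    simp
  set g : ℝ × ℝ → ℂ := fun p => φ ((p.1 - (u + ρ)) ^ 2 + p.2 ^ 2) with hg_def
  have hfg : ∀ x : Fin 1 → E4, f x = g (x 0 0, x 0 1) * hh (x 0 2, x 0 3) := fun x => by rw [hf x]
  have hgsupp : ∀ p : ℝ × ℝ, g p ≠ 0 → u ≤ p.1 ∧ p.1 ≤ 2 * u := by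
    intro p hp
    have h2 : (p.1 - (u + ρ)) ^ 2 + p.2 ^ 2 ≤ ρ ^ 2 := not_lt.1 fun h' => hp (hφ _ h')
    have hab : |p.1 - (u + ρ)| ≤ ρ := abs_le_of_sq_le_sq (by nlinarith [sq_nonneg p.2]) hρ.le
    have := abs_le.1 hab
    constructor <;> linarith
  have hshift : g = fun p : ℝ × ℝ => (fun p : ℝ × ℝ => φ (p.1 ^ 2 + p.2 ^ 2)) (p - ((u + ρ), (0 : ℝ))) := by
    funext p; simp [hg_def]
  have hgi : MeasureTheory.Integrable g := by
    rw [hshift]; exact hφi.comp_sub_right _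
  have hgM : (∫ p, ‖g p‖) ≤ 1 := by
    have : (∫ p, ‖g p‖) = ∫ p : ℝ × ℝ, ‖φ (p.1 ^ 2 + p.2 ^ 2)‖ := by
      rw [hshift]
      exact MeasureTheory.integral_sub_right_eq_self (fun p : ℝ × ℝ => ‖φ (p.1 ^ 2 + p.2 ^ 2)‖) _
    rw [this]; exact hφ1
  obtain ⟨hhi, hhM, hhM'⟩ := hhh
  have hbound := fun (W : SchwartzMap (Fin n → E4) ℂ) (hW : IsTimeOrdered W)
      (hFW : IsTimeOrdered (SchwartzMap.appendTensor f (translateMulti ((2 * u + u) • EuclideanSpace.single 0 1) W))) =>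
    hS u u hu hu hu1 hu1 f g hh 1 A A hfg hgsupp hgi hgM hhi hhM hhM' n W hW hFW
  obtain ⟨B, hBn, hB⟩ := stub_insertionOps S₁ h n f ((2 * u + u) • EuclideanSpace.single 0 1)
    (C * 1 * (A + A) * (u ^ (-μ) + u ^ (-μ))) hbound
  exact ⟨f, B, hf, hBn, hB⟩

/-- **Stub (A3) — THE CHAIN OF A TERM WITH A FREE LOWER BLOCK.** -/
theorem stub_asmTermChainFree :
    open Literature.MathematicalPhysics.QuantumLattice Literature.MathematicalPhysics.AQFT
      Literature.MathematicalPhysics.QuantumFieldTheory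
      Summit.QuantumFields.YangMills.Theorems.CurvatureBoostCovariance.Negative
      Summit.QuantumFields.YangMills.Theorems.NPointIsotropy.Negative in
    ∀ (S₁ : SchwingerFamily E4) (h : OSReconstructionNoE1 S₁.toLabelled)
      (N : ℂ × ℂ → (h.Hilbert →L[ℂ] h.Hilbert)),
      (∀ p : ℂ × ℂ, |p.2.im| < p.1.re → ‖N p‖ ≤ 1) →
      (∀ ψ ψ' : h.Hilbert, DifferentiableOn ℂ (fun p : ℂ × ℂ => ⟪ψ, N p ψ'⟫_ℂ) {p : ℂ × ℂ | |p.2.im| < p.1.re}) →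
      (∀ (t b : ℝ), 0 < t → ∀ ψ : h.Hilbert,
        N ((t : ℂ), (b : ℂ)) ψ = h.transfer t (h.translate (b • EuclideanSpace.single 1 1) ψ)) →
      Translations S₁ →
      ∀ (μ C : ℝ),
        (∀ (u v : ℝ), 0 < u → 0 < v → u ≤ 1 → v ≤ 1 →
           ∀ (f₁ : SchwartzMap (Fin 1 → E4) ℂ) (g hh : ℝ × ℝ → ℂ) (Mg Mh Mh' : ℝ),
             (∀ x : Fin 1 → E4, f₁ x = g (x 0 0, x 0 1) * hh (x 0 2, x 0 3)) →
             (∀ p : ℝ × ℝ, g p ≠ 0 → u ≤ p.1 ∧ p.1 ≤ 2 * u) →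
             MeasureTheory.Integrable g → (∫ p, ‖g p‖) ≤ Mg →
             MeasureTheory.Integrable hh → (∫ p, ‖hh p‖) ≤ Mh → (∀ p, ‖hh p‖ ≤ Mh') →
           ∀ (n : ℕ) (W : SchwartzMap (Fin n → E4) ℂ) (hW : IsTimeOrdered W)
             (hFW : IsTimeOrdered
               (SchwartzMap.appendTensor f₁ (translateMulti ((2 * u + v) • EuclideanSpace.single 0 1) W))),
             ‖h.fieldVec (1 + n) (fun _ => ())
                 (SchwartzMap.appendTensor f₁ (translateMulti ((2 * u + v) • EuclideanSpace.single 0 1) W)) hFW‖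
               ≤ C * Mg * (Mh + Mh') * (u ^ (-μ) + v ^ (-μ)) * ‖h.fieldVec n (fun _ => ()) W hW‖) →
      ∀ (m : ℕ) (δ ε ρ u R A : ℝ) (φ : ℝ → ℂ) (hh : Fin (m + 1) → ℝ × ℝ → ℂ)
        (f0 : Fin (m + 1) → SchwartzMap (Fin 1 → E4) ℂ) (c : Fin (m + 1) → ℝ × ℝ) (T : SchwartzMap (Fin (m + 1) → E4) ℂ),
        0 < δ → δ ≤ 1 → 0 < ε → 0 < ρ → ρ ≤ δ / 32 → 0 < R → 2 * ρ ≤ u → u * Real.exp R ≤ δ / 16 →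
        (∀ (θ : ℝ) (F : SchwartzMap (Fin (m + m) → E4) ℂ), IsOffDiagonal F →
          S₁ (m + m) (linActMulti (planeRot (0 : Fin 3) θ) F) = S₁ (m + m) F) →
        (∀ s : ℝ, ρ ^ 2 < s → φ s = 0) →
        MeasureTheory.Integrable (fun p : ℝ × ℝ => φ (p.1 ^ 2 + p.2 ^ 2)) →
        (∫ p : ℝ × ℝ, ‖φ (p.1 ^ 2 + p.2 ^ 2)‖) ≤ 1 →
        (∀ (j : Fin (m + 1)) (x : Fin 1 → E4), f0 j x = φ ((x 0 0) ^ 2 + (x 0 1) ^ 2) * hh j (x 0 2, x 0 3)) →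
        (∀ x : Fin (m + 1) → E4, T x = ∏ j, φ ((x j 0 - (c j).1) ^ 2 + (x j 1 - (c j).2) ^ 2) * hh j (x j 2, x j 3)) →
        (∀ j : Fin (m + 1), MeasureTheory.Integrable (hh j) ∧ (∫ p : ℝ × ℝ, ‖hh j p‖) ≤ A ∧ ∀ p : ℝ × ℝ, ‖hh j p‖ ≤ A) →
        (∀ θ : ℝ, |θ| < ε →
          (∀ j : Fin (m + 1), δ ≤ Real.cos θ * (c j).1 + Real.sin θ * (c j).2) ∧
          (∀ i j : Fin (m + 1), i < j → δ / 2 ≤ (Real.cos θ * (c j).1 + Real.sin θ * (c j).2) -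
            (Real.cos θ * (c i).1 + Real.sin θ * (c i).2))) →
        (∀ θ : ℝ, |θ| < ε → IsTimeOrdered (linActMulti (planeRot (0 : Fin 3) θ) T)) ∧
        ∃ V : ℂ → h.Hilbert,
          DifferentiableOn ℂ V {ζ : ℂ | |ζ.re| < ε ∧ |ζ.im| < R} ∧
          (∀ ζ : ℂ, |ζ.re| < ε → |ζ.im| < R →
            ‖V ζ‖ ≤ max (C * 1 * (A + A) * (u ^ (-μ) + u ^ (-μ))) 0 *
              (max (C * 1 * (A + A) * ((δ / 16) ^ (-μ) + (δ / 16) ^ (-μ))) 0) ^ m *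
              ‖h.fieldVec 0 (fun _ => ()) (SchwartzMap.constOfSubsingleton 1)
                OSReconstructionNoE1.isTimeOrdered_constOfSubsingleton‖) ∧
          (∀ θ : ℝ, |θ| < ε → ∀ hθ : IsTimeOrdered (linActMulti (planeRot (0 : Fin 3) θ) T),
            V θ = h.fieldVec (m + 1) (fun _ => ()) (linActMulti (planeRot (0 : Fin 3) θ) T) hθ) := by
  intro S₁ h N hN1 hN2 hN3 htr μ C hS m δ ε ρ u R A φ hh f0 c T hδ hδ1 hε hρ hρ32 hR h2ρ huR hInv hφ hφi hφ1
    hf0 hT hhh hgeo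
  -- Step 0: elementary consequences for the reserves
  have hu : 0 < u := by linarith
  have heR : Real.exp (-R) * Real.exp R = 1 := by rw [← Real.exp_add]; simp
  have heR0 : 0 < Real.exp (-R) := Real.exp_pos _
  have hu' : u ≤ δ / 16 * Real.exp (-R) := by
    have := mul_le_mul_of_nonneg_right huR heR0.le
    calc u = u * Real.exp R * Real.exp (-R) := by rw [mul_assoc, mul_comm (Real.exp R), heR, mul_one]
      _ ≤ δ / 16 * Real.exp (-R) := this
  have heR1 : Real.exp (-R) ≤ 1 := Real.exp_le_one_iff.2 (by linarith)
  have hu16 : u ≤ δ / 16 := hu'.trans (by nlinarith)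
  have hu1 : u ≤ 1 := by linarith
  have h2ρ' : 2 * ρ ≤ δ / 16 := by linarith
  have hδ16 : δ / 16 ≤ 1 := by linarith
  have hq := three_quarters_le_exp_neg_quarter
  set Ψ1 : ℝ := ‖h.fieldVec 0 (fun _ => ()) (SchwartzMap.constOfSubsingleton 1)
      OSReconstructionNoE1.isTimeOrdered_constOfSubsingleton‖ with hΨ1_def
  -- Step 1: the tail tensor `Y` (items `1, …, m`)
  obtain ⟨Y, hY⟩ := exists_bumpTensor_asm φ (fun j : Fin m => hh j.succ) (fun j => f0 j.succ) (fun j => c j.succ)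
    (fun j => hf0 j.succ)
  have hhhY : ∀ j : Fin m, MeasureTheory.Integrable (hh j.succ) ∧ (∫ p : ℝ × ℝ, ‖hh j.succ p‖) ≤ A ∧
      ∀ p : ℝ × ℝ, ‖hh j.succ p‖ ≤ A := fun j => hhh j.succ
  -- tail geometry seen from `q = c 0`
  have hgeoY : ∀ θ : ℝ, |θ| < ε →
      (∀ j : Fin m, (j : ℕ) = 0 →
        δ / 2 ≤ Real.cos θ * ((c j.succ).1 - (c 0).1) + Real.sin θ * ((c j.succ).2 - (c 0).2)) ∧
      (∀ i j : Fin m, (j : ℕ) = i + 1 →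
        δ / 2 ≤ Real.cos θ * ((c j.succ).1 - (c i.succ).1) + Real.sin θ * ((c j.succ).2 - (c i.succ).2)) := by
    intro θ hθ
    obtain ⟨-, h2⟩ := hgeo θ hθ
    refine ⟨fun j _ => ?_, fun i j hij => ?_⟩
    · have := h2 0 j.succ (Fin.succ_pos j)
      linarith
    · have hlt : i.succ < j.succ := by rw [Fin.lt_def]; simp; omega
      have := h2 i.succ j.succ hlt
      linarith
  -- full geometry seen from `q = 0`
  have hgeoT : ∀ θ : ℝ, |θ| < ε →
      (∀ j : Fin (m + 1), (j : ℕ) = 0 →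
        δ ≤ Real.cos θ * ((c j).1 - ((0 : ℝ), (0 : ℝ)).1) + Real.sin θ * ((c j).2 - ((0 : ℝ), (0 : ℝ)).2)) ∧
      (∀ i j : Fin (m + 1), (j : ℕ) = i + 1 →
        δ / 2 ≤ Real.cos θ * ((c j).1 - (c i).1) + Real.sin θ * ((c j).2 - (c i).2)) := by
    intro θ hθ
    obtain ⟨h1, h2⟩ := hgeo θ hθ
    refine ⟨fun j _ => by simpa using h1 j, fun i j hij => ?_⟩
    have hlt : i < j := Fin.lt_def.2 (by omega)
    have := h2 i j hlt
    linarith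
  -- Step 2: (G) four times
  -- (T) the whole tensor from `q = 0`, `w = 0`, reserve `u`, height `R`: time-ordering of `R_θ T`
  have hres1 : 0 + u + ρ ≤ δ * Real.exp (-R) := by nlinarith
  have hres2 : 3 * u ≤ δ / 2 * Real.exp (-R) := by nlinarith
  obtain ⟨hTOT, -⟩ := stub_asmBumpChainOps S₁ h N hN1 hN2 hN3 μ C hS (m + 1) u ρ 0 ε R δ (δ / 2) A φ hh f0 c
    ((0 : ℝ), (0 : ℝ)) T hρ h2ρ hu1 le_rfl hε hR hδ (by positivity) hres1 hres2 hφ hφi hφ1 hf0 hT hhh hgeoT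
  have hTOT' : ∀ θ : ℝ, |θ| < ε → IsTimeOrdered (linActMulti (planeRot (0 : Fin 3) θ) T) := fun θ hθ => by
    have := hTOT θ hθ; rwa [cfg_zero_eq] at this
  -- (a) the tail at height `R`, `q = c 0`, `w = u + u - ρ`, reserve `u`
  have hwa : 0 ≤ u + u - ρ := by linarith
  have hres1a : (u + u - ρ) + u + ρ ≤ δ / 2 * Real.exp (-R) := by nlinarith
  obtain ⟨hTOa, Va, hVad, hVab, hVar⟩ := stub_asmBumpChainOps S₁ h N hN1 hN2 hN3 μ C hS m u ρ (u + u - ρ) ε R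
    (δ / 2) (δ / 2) A φ (fun j => hh j.succ) (fun j => f0 j.succ) (fun j => c j.succ) (c 0) Y hρ h2ρ hu1 hwa hε hR
    (by positivity) (by positivity) hres1a hres2 hφ hφi hφ1 (fun j => hf0 j.succ) hY hhhY hgeoY
  -- (b) the tail at height `1/4`, `q = c 0`, `w = δ/8`, reserve `δ/16`: the FIXED real bound
  have hres1b : δ / 8 + δ / 16 + ρ ≤ δ / 2 * Real.exp (-(1 / 4 : ℝ)) := by nlinarith
  have hres2b : 3 * (δ / 16) ≤ δ / 2 * Real.exp (-(1 / 4 : ℝ)) := by nlinarith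
  obtain ⟨hTOb, Vb, -, hVbb, hVbr⟩ := stub_asmBumpChainOps S₁ h N hN1 hN2 hN3 μ C hS m (δ / 16) ρ (δ / 8) ε (1 / 4)
    (δ / 2) (δ / 2) A φ (fun j => hh j.succ) (fun j => f0 j.succ) (fun j => c j.succ) (c 0) Y hρ h2ρ' hδ16
    (by positivity) hε (by norm_num) (by positivity) (by positivity) hres1b hres2b hφ hφi hφ1 (fun j => hf0 j.succ)
    hY hhhY hgeoY
  -- (c) the tail advanced by `2·(δ/8)`: time-ordering only
  have hres1c : 2 * (δ / 8) + δ / 16 + ρ ≤ δ / 2 * Real.exp (-(1 / 4 : ℝ)) := by nlinarith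
  obtain ⟨hTOc, -⟩ := stub_asmBumpChainOps S₁ h N hN1 hN2 hN3 μ C hS m (δ / 16) ρ (2 * (δ / 8)) ε (1 / 4)
    (δ / 2) (δ / 2) A φ (fun j => hh j.succ) (fun j => f0 j.succ) (fun j => c j.succ) (c 0) Y hρ h2ρ' hδ16
    (by positivity) hε (by norm_num) (by positivity) (by positivity) hres1c hres2b hφ hφi hφ1 (fun j => hf0 j.succ)
    hY hhhY hgeoY
  -- Step 3: the lower block (T5): `‖Va ζ‖ ≤ ‖Ψ_{Ỹ_{Re ζ}}‖ ≤ Kfix^m Ψ1`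
  set Kfix : ℝ := max (C * 1 * (A + A) * ((δ / 16) ^ (-μ) + (δ / 16) ^ (-μ))) 0 with hKfix_def
  have hwpos : 0 < u + u - ρ := by linarith
  have hwg : (u + u - ρ) * Real.exp R ≤ δ / 8 := by nlinarith [Real.exp_pos R]
  have hT5 := stub_lowerBlock S₁ h N hN1 hN2 hN3 htr m Y (c 0) (u + u - ρ) (δ / 8) ε R Va hwpos hε hR hwg hInv hVad
    (fun θ hθ => ⟨hTOa θ hθ, hVar θ hθ (hTOa θ hθ)⟩) hTOc
  have hVaM : ∀ ζ : ℂ, |ζ.re| < ε → |ζ.im| < R → ‖Va ζ‖ ≤ Kfix ^ m * Ψ1 := by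
    intro ζ h1 h2
    have hre : |((ζ.re : ℝ) : ℂ).re| < ε := by simpa using h1
    have hb := hVbb (ζ.re : ℂ) hre (by norm_num)
    rw [hVbr ζ.re h1 (hTOb ζ.re h1)] at hb
    exact (hT5 ζ h1 h2 (hTOb ζ.re h1)).trans hb
  -- Step 4: item `0` at reserve `u`, its insertion operator, and the first link (T3a)
  obtain ⟨f, B, hf, hBn, hB⟩ := exists_item_insertionOp_free h hS (f0 0) hρ h2ρ hu1 hφ hφi hφ1 (hf0 0) (hhh 0) m
  have htube : ∀ ζ : ℂ, |ζ.re| < ε → |ζ.im| < R →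
      |(-Complex.sin ζ * ((c 0).1 - ((0 : ℝ), (0 : ℝ)).1) + Complex.cos ζ * ((c 0).2 - ((0 : ℝ), (0 : ℝ)).2)).im| <
        (Complex.cos ζ * ((c 0).1 - ((0 : ℝ), (0 : ℝ)).1) + Complex.sin ζ * ((c 0).2 - ((0 : ℝ), (0 : ℝ)).2)).re -
          (0 + u + ρ) := by
    intro ζ h1 h2
    have key := tube_of_gap (Δ₁ := (c 0).1 - ((0 : ℝ), (0 : ℝ)).1) (Δ₂ := (c 0).2 - ((0 : ℝ), (0 : ℝ)).2) hδ hres1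
      (fun x hx => by simpa using (hgeo x hx).1 0) h1 h2
    exact_mod_cast key
  obtain ⟨hVd, hVb, hVr⟩ := stub_bumpChainLink S₁ h N hN1 hN2 hN3 m u u ρ 0 ε R (Kfix ^ m * Ψ1) φ (hh 0) f B Y (c 0)
    ((0 : ℝ), (0 : ℝ)) Va hu hu hρ h2ρ le_rfl hR hφ hf hB hVad hVaM
    (fun θ hθ => ⟨hTOa θ hθ, hVar θ hθ (hTOa θ hθ)⟩) htube
  refine ⟨hTOT', _, hVd, fun ζ h1 h2 => (hVb ζ h1 h2).trans ?_, fun θ hθ hθ' => ?_⟩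
  · -- the bound: `‖B‖ · Kfix^m Ψ1 ≤ Kof_u · Kfix^m · Ψ1`
    have : 0 ≤ Kfix ^ m * Ψ1 := by positivity
    calc ‖B‖ * (Kfix ^ m * Ψ1) ≤ max (C * 1 * (A + A) * (u ^ (-μ) + u ^ (-μ))) 0 * (Kfix ^ m * Ψ1) :=
          mul_le_mul_of_nonneg_right hBn this
      _ = _ := by rw [hKfix_def]; ring
  · -- the real values: the `G` of (T3a) is `R_θ T`
    refine hVr θ hθ (linActMulti (planeRot (0 : Fin 3) θ) T) (fun x => ?_) hθ'
    have e1 : linActMulti (planeRot (0 : Fin 3) θ) T x = translateMulti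
        (-((Real.cos θ * ((0 : ℝ), (0 : ℝ)).1 + Real.sin θ * ((0 : ℝ), (0 : ℝ)).2 + 0) • EuclideanSpace.single 0 1 +
          (-Real.sin θ * ((0 : ℝ), (0 : ℝ)).1 + Real.cos θ * ((0 : ℝ), (0 : ℝ)).2) • EuclideanSpace.single 1 1))
        (linActMulti (planeRot (0 : Fin 3) θ) T) x := by rw [cfg_zero_eq]
    rw [e1, cfg_apply_bc φ hh c T hT θ ((0 : ℝ), (0 : ℝ)) 0 x, Fin.prod_univ_succ,
      cfg_apply_bc φ (fun j => hh j.succ) (fun j => c j.succ) Y hY θ ((0 : ℝ), (0 : ℝ)) 0 (Fin.tail x)]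
    rfl

end Summit.QuantumFields.YangMills.Theorems.SoftKernelBoostCovariance.Sketch

end
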